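import Summits.CriticalPhenomena.CardyFormulaZ2.Theses.CardySelfDualSegment
import Literature.Probability.Percolation.CornerPercolation
import Literature.Probability.Percolation.CardyFormula
import Literature.Probability.LatticeModels.TriangularLatticeProofs
import Literature.Probability.RandomPlanarGeometry.ConformalRectangleProofs
import Literature.Probability.RandomPlanarGeometry.ChordalCurveFamily
import Literature.Probability.RandomPlanarGeometry.TriangleDomain
import Literature.Probability.RandomPlanarGeometry.CritPercCardyFunctionHolds
import Literature.Probability.RandomPlanarGeometry.CardyFunctionIncBeta
import Literature.Barriers.CriticalPhenomena.EmbeddingModulusUniquenessProofs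

/-!
# Negative lemmas for the crux `CardySelfDualSegment.SmirnovBasePoint` (stmt-CriticalPhenomena-5474)

Refuter seat `refuter-cdisprove-stmt-CriticalPhenomena-5474-0`, cycle 1 (work file
`Cruxes/SmirnovBasePoint/Disproof.lean`). Everything proved, no `sorry`, no proposition defined,
no named fact; no Theses decl is asserted positively.

The crux says `CardyMod 0 ζ`: for all conformal rectangles `R, R'` with `R = φ_ζ R'`
(`φ_ζ = moduliShear triZeta`) and every uniformizing datum `(φ, x)` of `R`, the crude
`M_0`-crossing probability of `R'` tends to `F(crossRatio x)`.

* `exists_shear_data` — NON-VACUITY: for every `R'` (and every `β ∉ ℝ`) the three hypotheses are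
  met by `R'.map (shearHomeomorph β)` and a uniformizing datum; hence
  `not_smirnovBasePoint_of_forall_not_tendsto` — THE refutation template: one conformal rectangle
  whose crude `M_0` crossing probability has no limit refutes the crux.
* `cardyMod_zero_of_im_eq_zero` — DEGENERATE PARAMETERS: for REAL `β` the statement `CardyMod 0 β`
  holds vacuously (`φ_β` collapses `ℂ` onto `ℝ`; `carrier_ne_moduliShear_image`); so `0 < α.im` in
  the route's `G` is load-bearing, and the literal strengthening "the modulus of `M_0` is unique
  among all `β : ℂ`" is FALSE (`not_forall_cardyMod_zero_imp_eq_triZeta`).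
* `tendsto_carleson_of_smirnovBasePoint` / `not_smirnovBasePoint_of_carleson_limit_ne` — the
  CHIRALITY-SENSITIVE TEST: the crux forces `P_0(T_s, δ) → s` for the square-frame right triangle
  `T_s = φ_ζ⁻¹(Δ(0, √2, √2ζ); …)` (Carleson, tree fact
  `cardyFunction_crossRatio_eq_of_equilateral_holds`); any other limit refutes it. Compute job
  j017034 (evidence on the item): at `n = 256`, `0.2507(43) / 0.5001(50) / 0.7588(43)` for
  `s = 1/4, 1/2, 3/4` — passed; the mirror chirality gives `0.049 / 0.185 / 0.418`.
* `squeeze_false_without_lower` — line `Sketch`, stub `stub_squeeze`: its LOWER comparison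
  hypothesis is load-bearing (`pr := 0` obeys all upper bounds and does not tend to `F(η) > 0`), so
  the stub holds only through the existence of admissible lower quads (`exists_lowerQuad`).
-/

noncomputable section

namespace Summit.CriticalPhenomena.CardyFormulaZ2.Theorems.SmirnovBasePoint.Negative

open Summit.CriticalPhenomena.CardyFormulaZ2.Theses.CardySelfDualSegment
open Literature.Probability.RandomPlanarGeometry hiding cardyFunction
open Literature.Probability.Percolation hiding cardyFunction
open Literature.Probability.LatticeModels
open Literature.Barriers.CriticalPhenomena
open Filter Topology Set MeasureTheory Metric

/-! ## Non-vacuity and the refutation template -/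

/-- For every conformal rectangle `R'` and `β ∉ ℝ` the three hypotheses of `CardyMod t β` are met
(`R := R'.map φ_β`, Riemann–Carathéodory `exists_isUniformizing_holds`). [folklore] -/
theorem exists_shear_data {β : ℂ} (hβ : β.im ≠ 0) (R' : ConformalRectangle) :
    ∃ (R : ConformalRectangle) (φ : ConformalEquiv UpperHalfPlane.upperHalfPlaneSet R.carrier)
      (x : Fin 4 → ℝ), R.carrier = moduliShear β '' R'.carrier ∧
      (∀ i, R.pt i = moduliShear β (R'.pt i)) ∧ R.IsUniformizing φ x := by
  obtain ⟨φ, x, h⟩ :=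
    MarkedDomain.exists_isUniformizing_holds (R'.map (shearHomeomorph β hβ))
  exact ⟨R'.map (shearHomeomorph β hβ), φ, x, by simp, fun i => by simp, h⟩

/-- The crux pins `lim_{δ → 0⁺} P_0(R', δ)` (`cornerCrossingProb 0 R'`) for EVERY conformal
rectangle `R'`. [folklore] -/
theorem tendsto_of_smirnovBasePoint (h : SmirnovBasePoint) (R' : ConformalRectangle) :
    ∃ L : ℝ, Tendsto (cornerCrossingProb 0 R') (𝓝[>] 0) (𝓝 L) := by
  obtain ⟨R, φ, x, hc, hp, hu⟩ :=
    exists_shear_data Literature.Probability.Percolation.triZeta_im_ne_zero R'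
  exact ⟨_, h R R' φ x hc hp hu⟩

/-- REFUTATION TEMPLATE: one conformal rectangle whose crude `M_0` crossing probability does not
converge as `δ → 0⁺` refutes the crux. [folklore] -/
theorem not_smirnovBasePoint_of_forall_not_tendsto (R' : ConformalRectangle)
    (h : ∀ L : ℝ, ¬ Tendsto (cornerCrossingProb 0 R') (𝓝[>] 0) (𝓝 L)) : ¬ SmirnovBasePoint :=
  fun hS => by
    obtain ⟨L, hL⟩ := tendsto_of_smirnovBasePoint hS R'
    exact h L hL

/-! ## Degenerate shear parameters -/

/-- No conformal rectangle has its (open, nonempty) carrier inside the real axis: for real `β` the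
carrier hypothesis `R.carrier = φ_β '' R'.carrier` is never satisfied. [folklore] -/
theorem carrier_ne_moduliShear_image {β : ℂ} (hβ : β.im = 0) (R R' : ConformalRectangle) :
    R.carrier ≠ moduliShear β '' R'.carrier := by
  intro h
  obtain ⟨z, hz⟩ := R.toJordanDomain.nonempty
  obtain ⟨ε, hε, hball⟩ := Metric.isOpen_iff.1 R.isOpen z hz
  have hmem : z + (ε / 2 : ℝ) * Complex.I ∈ R.carrier := by
    apply hball
    rw [Metric.mem_ball, dist_eq_norm]
    have : z + (ε / 2 : ℝ) * Complex.I - z = (ε / 2 : ℝ) * Complex.I := by ring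
    rw [this, norm_mul, Complex.norm_real, Complex.norm_I, mul_one, Real.norm_eq_abs,
      abs_of_pos (by positivity)]
    linarith
  have him : ∀ w ∈ R.carrier, w.im = 0 := by
    intro w hw
    rw [h] at hw
    obtain ⟨u, -, rfl⟩ := hw
    simp [moduliShear, hβ]
  have h1 := him z hz
  have h2 := him _ hmem
  simp [h1] at h2
  exact hε.ne' h2

/-- DEGENERATE INSTANCE: for real `β` the statement `CardyMod 0 β` (spelled over the tree API)
holds VACUOUSLY. The route's `0 < α.im` conjunct is therefore load-bearing. [folklore] -/
theorem cardyMod_zero_of_im_eq_zero {β : ℂ} (hβ : β.im = 0) :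
    ∀ (R R' : ConformalRectangle) (φ : ConformalEquiv UpperHalfPlane.upperHalfPlaneSet R.carrier)
      (x : Fin 4 → ℝ), R.carrier = moduliShear β '' R'.carrier →
      (∀ i, R.pt i = moduliShear β (R'.pt i)) → R.IsUniformizing φ x →
      Tendsto (cornerCrossingProb 0 R') (𝓝[>] 0)
        (𝓝 (Literature.Probability.RandomPlanarGeometry.cardyFunction (crossRatio x))) :=
  fun R R' _ _ hc _ _ => absurd hc (carrier_ne_moduliShear_image hβ R R')

/-- `ζ ≠ 0`. [folklore] -/
theorem triZeta_ne_zero : triZeta ≠ 0 := fun h => by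
  have := congrArg Complex.im h
  rw [triZeta_im, Complex.zero_im] at this
  have h3 : 0 < Real.sqrt 3 := Real.sqrt_pos.2 (by norm_num)
  linarith

/-- REFUTED STRENGTHENING: "the modulus of `M_0` is unique among ALL `β : ℂ`" is false as a
literal statement — `β = 0` satisfies `CardyMod 0 β` vacuously. [folklore] -/
theorem not_forall_cardyMod_zero_imp_eq_triZeta :
    ¬ ∀ β : ℂ, (∀ (R R' : ConformalRectangle)
        (φ : ConformalEquiv UpperHalfPlane.upperHalfPlaneSet R.carrier) (x : Fin 4 → ℝ),
        R.carrier = moduliShear β '' R'.carrier → (∀ i, R.pt i = moduliShear β (R'.pt i)) →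
        R.IsUniformizing φ x →
        Tendsto (cornerCrossingProb 0 R') (𝓝[>] 0)
          (𝓝 (Literature.Probability.RandomPlanarGeometry.cardyFunction (crossRatio x)))) →
      β = triZeta :=
  fun h => triZeta_ne_zero (h 0 (cardyMod_zero_of_im_eq_zero rfl)).symm

/-! ## The chirality-sensitive Carleson test -/

/-- `‖ζ‖ = 1` and `‖1 - ζ‖ = 1`. [folklore] -/
theorem norm_triZeta_and_norm_one_sub : ‖triZeta‖ = 1 ∧ ‖1 - triZeta‖ = 1 := by
  have key : ∀ w : ℂ, w.re * w.re + w.im * w.im = 1 → ‖w‖ = 1 := fun w hw => by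
    have h : ‖w‖ ^ 2 = 1 := by rw [Complex.sq_norm, Complex.normSq_apply]; exact hw
    exact (pow_eq_one_iff_of_nonneg (norm_nonneg w) two_ne_zero).1 h
  have h3 : Real.sqrt 3 * Real.sqrt 3 = 3 := Real.mul_self_sqrt (by norm_num)
  refine ⟨key _ ?_, key _ ?_⟩
  · rw [triZeta_re, triZeta_im]; nlinarith
  · simp only [Complex.sub_re, Complex.one_re, Complex.sub_im, Complex.one_im, triZeta_re, triZeta_im]
    nlinarith

/-- The vertices `0, √2, √2 ζ` form an equilateral triangle of side `√2`. [folklore] -/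
theorem carleson_equilateral :
    dist (0 : ℂ) (Real.sqrt 2) = dist (Real.sqrt 2 : ℂ) (Real.sqrt 2 * triZeta) ∧
      dist (Real.sqrt 2 : ℂ) (Real.sqrt 2 * triZeta) = dist (Real.sqrt 2 * triZeta) 0 ∧
        (0 : ℂ) ≠ Real.sqrt 2 := by
  have h2 : (0 : ℝ) < Real.sqrt 2 := Real.sqrt_pos.2 (by norm_num)
  have hn : ‖(Real.sqrt 2 : ℂ)‖ = Real.sqrt 2 := by
    rw [Complex.norm_real, Real.norm_eq_abs, abs_of_pos h2]
  have d1 : dist (0 : ℂ) (Real.sqrt 2) = Real.sqrt 2 := by rw [dist_comm, dist_zero_right, hn]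
  have d2 : dist (Real.sqrt 2 : ℂ) (Real.sqrt 2 * triZeta) = Real.sqrt 2 := by
    rw [dist_eq_norm, show (Real.sqrt 2 : ℂ) - Real.sqrt 2 * triZeta = Real.sqrt 2 * (1 - triZeta)
      by ring, norm_mul, hn, norm_triZeta_and_norm_one_sub.2, mul_one]
  have d3 : dist (Real.sqrt 2 * triZeta) 0 = Real.sqrt 2 := by
    rw [dist_zero_right, norm_mul, hn, norm_triZeta_and_norm_one_sub.1, mul_one]
  refine ⟨by rw [d1, d2], by rw [d2, d3], fun h => ?_⟩
  have := congrArg Complex.re h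
  simp at this
  exact h2.ne' this.symm

/-- Affine independence of `0, √2, √2ζ`. [folklore] -/
theorem carleson_affineIndependent :
    AffineIndependent ℝ ![(0 : ℂ), (Real.sqrt 2 : ℂ), (Real.sqrt 2 : ℂ) * triZeta] :=
  affineIndependent_of_dist_eq carleson_equilateral.1 carleson_equilateral.2.1
    carleson_equilateral.2.2

/-- `√2 ζ ≠ 0`. [folklore] -/
theorem sqrt_two_mul_triZeta_ne_zero : (Real.sqrt 2 : ℂ) * triZeta ≠ 0 :=
  mul_ne_zero (by
    have h2 : (0 : ℝ) < Real.sqrt 2 := Real.sqrt_pos.2 (by norm_num)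
    exact_mod_cast h2.ne') triZeta_ne_zero

/-- **The Carleson prediction.** The crux forces: for `s ∈ (0,1)`, the crude `M_0` crossing
probability of the square-frame triangle `T_s := φ_ζ⁻¹ (Δ(0, √2, √2ζ); 0, √2, √2ζ, (1-s)√2ζ)` —
the open right isosceles triangle `(0, √2, i√2)` with fourth point `i√2(1-s)`, in lattice units
`{(a,b) : a, b > 0, a + b < n}` at `δ = 1/n` — tends to `s` (Carleson's form of Cardy's formula,
`cardyFunction_crossRatio_eq_of_equilateral_holds`). Tested by compute job j017034 (passed).
[cite: BollobasRiordan2006, Ch. 7 (3) p. 163] -/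
theorem tendsto_carleson_of_smirnovBasePoint (h : SmirnovBasePoint) (s : ℝ) (hs : s ∈ Ioo (0 : ℝ) 1) :
    Tendsto (cornerCrossingProb 0
      ((triangleRectangle 0 (Real.sqrt 2) (Real.sqrt 2 * triZeta) carleson_affineIndependent s hs).map
        (shearHomeomorph triZeta Literature.Probability.Percolation.triZeta_im_ne_zero).symm))
      (𝓝[>] 0) (𝓝 s) := by
  set T := triangleRectangle 0 (Real.sqrt 2) (Real.sqrt 2 * triZeta) carleson_affineIndependent s hs
    with hT
  set ψ := shearHomeomorph triZeta Literature.Probability.Percolation.triZeta_im_ne_zero with hψ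
  obtain ⟨φ, x, hu⟩ := MarkedDomain.exists_isUniformizing_holds T
  have hlim := h T (T.map ψ.symm) φ x
    (by
      show T.carrier = ψ '' (ψ.symm '' T.carrier)
      exact (ψ.image_symm_image _).symm)
    (fun i => by
      show T.pt i = ψ (ψ.symm (T.pt i))
      exact (ψ.apply_symm_apply _).symm)
    hu
  obtain ⟨h0, h1, h2, h3⟩ := triangleRectangle_pt carleson_affineIndependent hs
    (a := 0) (b := (Real.sqrt 2 : ℂ)) (c := Real.sqrt 2 * triZeta)
  have hc0 := sqrt_two_mul_triZeta_ne_zero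
  have hd : T.pt 3 - Real.sqrt 2 * triZeta = s • ((0 : ℂ) - Real.sqrt 2 * triZeta) := by
    rw [h3]; ring
  have hF := cardyFunction_crossRatio_eq_of_equilateral_holds T 0 (Real.sqrt 2)
    (Real.sqrt 2 * triZeta) (T.pt 3) carleson_equilateral rfl ⟨h0, h1, h2, rfl⟩
    (by rw [h3, segment_eq_image']; exact ⟨s, Ioo_subset_Icc_self hs, rfl⟩)
    (by
      intro hdc
      have : s • ((0 : ℂ) - Real.sqrt 2 * triZeta) = 0 := by rw [← hd, hdc, sub_self]
      rw [smul_eq_zero] at this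
      rcases this with h' | h'
      · exact hs.1.ne' h'
      · exact hc0 (by rwa [zero_sub, neg_eq_zero] at h'))
    (by
      intro hda
      have e : (1 - s) • ((Real.sqrt 2 : ℂ) * triZeta) = T.pt 3 := by
        rw [h3, sub_smul, one_smul, smul_sub, smul_zero, zero_sub, sub_eq_add_neg]
      have : (1 - s) • ((Real.sqrt 2 : ℂ) * triZeta) = 0 := by rw [e, hda]
      rw [smul_eq_zero] at this
      rcases this with h' | h'
      · exact hs.2.ne (by linarith)
      · exact hc0 h')
    hu
  have hval : ‖T.pt 3 - Real.sqrt 2 * triZeta‖ / ‖(0 : ℂ) - Real.sqrt 2 * triZeta‖ = s := by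
    rw [hd, norm_smul, Real.norm_eq_abs, abs_of_pos hs.1, mul_div_assoc, div_self, mul_one]
    rw [norm_ne_zero_iff, zero_sub, neg_ne_zero]
    exact hc0
  rw [hval] at hF
  rw [hF] at hlim
  exact hlim

/-- REFUTATION TEMPLATE (numerical form): if for some `s ∈ (0,1)` the crude `M_0` crossing
probability of `T_s` tends to a limit `L ≠ s`, the crux is false. (j017034: no such `s` seen.)
[folklore] -/
theorem not_smirnovBasePoint_of_carleson_limit_ne {s : ℝ} (hs : s ∈ Ioo (0 : ℝ) 1) {L : ℝ}
    (hL : Tendsto (cornerCrossingProb 0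
      ((triangleRectangle 0 (Real.sqrt 2) (Real.sqrt 2 * triZeta) carleson_affineIndependent s hs).map
        (shearHomeomorph triZeta Literature.Probability.Percolation.triZeta_im_ne_zero).symm))
      (𝓝[>] 0) (𝓝 L))
    (hne : L ≠ s) : ¬ SmirnovBasePoint := fun h =>
  hne (tendsto_nhds_unique hL (tendsto_carleson_of_smirnovBasePoint h s hs))

/-! ## Line `Sketch`: the LOWER hypothesis of `stub_squeeze` is load-bearing -/

/-- `stub_squeeze` with its LOWER comparison hypothesis deleted is FALSE: `pr := 0` satisfies every
upper bound `pr ≤ P(N)` and does not tend to `F(η) > 0` (here for the unit disc). So the stub is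
true only through the existence of admissible lower quads (`OracleSandwich.exists_lowerQuad`).
[folklore] -/
theorem squeeze_false_without_lower :
    ¬ ∀ (R : ConformalRectangle) (pr : ℝ → ℝ),
      (∀ (N : ConformalRectangle) (r m τ : ℝ), 0 < r → 0 < m → 0 < τ →
        (∀ p ∈ R.arc 0, ∀ q ∈ R.arc 2, 3 * τ < dist p q) →
        (∀ z ∈ N.arc 1 ∪ N.arc 3, ∀ w ∈ R.carrier, r ≤ dist z w) →
        (∀ z ∈ R.carrier, z ∉ N.carrier → infDist z (R.arc 0) ≤ τ ∨ infDist z (R.arc 2) ≤ τ) →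
        (∀ z ∈ N.carrier, z ∈ R.carrier → m ≤ infDist z (R.arc 0) ∧ m ≤ infDist z (R.arc 2)) →
        (∀ z ∈ N.arc 0, infDist z (R.arc 0) ≤ τ) → (∀ z ∈ N.arc 2, infDist z (R.arc 2) ≤ τ) →
        ∃ δ₀ > 0, ∀ δ : ℝ, 0 < δ → δ < δ₀ → pr δ ≤ triDomainCrossingProb N δ) →
      R.HasCrossingLimit pr Literature.Probability.RandomPlanarGeometry.cardyFunction := by
  intro h
  have hR := h ConformalRectangle.unitDisc (fun _ => 0)
    (fun N _ _ _ _ _ _ _ _ _ _ _ _ => ⟨1, one_pos, fun δ _ _ => (triDomainCrossingProb_mem_Icc N δ).1⟩)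
  obtain ⟨φ, x, hu⟩ := MarkedDomain.exists_isUniformizing_holds ConformalRectangle.unitDisc
  have ht := hR φ x hu
  have hη := ConformalRectangle.crossRatio_mem_Ioo_of_isUniformizing hu
  have hpos : 0 < Literature.Probability.RandomPlanarGeometry.cardyFunction (crossRatio x) := by
    have hmono := strictMonoOn_cardyFunction_holds
    have := hmono (left_mem_Icc.2 zero_le_one) ⟨hη.1.le, hη.2.le⟩ hη.1
    rwa [cardyFunction_zero] at this
  have heq := tendsto_nhds_unique (tendsto_const_nhds (x := (0 : ℝ)) (f := 𝓝[>] (0 : ℝ))) ht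
  exact hpos.ne heq

end Summit.CriticalPhenomena.CardyFormulaZ2.Theorems.SmirnovBasePoint.Negative
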